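import Summits.QuantumFields.YangMills.Theorems.PoincareLipschitzFlatOrganOfFlatCapped
import Summits.QuantumFields.YangMills.Theorems.PoincareLipschitzBlowDownL2Compactness
import Literature.Analysis.FunctionSpaces.SobolevDomain
import HarnessLib

/-!
# Crux `HistoryTailL` (stmt-QuantumFields-19936) ∕ K2 crux `BlockLipschitzL` (stmt-QuantumFields-23533) — FILE K-8a «THE ORGAN FROM THE TWO SOBOLEV STUBS»:
# the band organ, the flat organ `hImproveCoreFlat` v1 VERBATIM and the face `hHalvingBand` v1 VERBATIM from S1″-band and S2♭″ alone (Γ1 and the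
# stability cap discharged BY NAME), Theorems-side

Cell `ym3-torus` (YM ladder rung R3 = continuum SU(2) Yang–Mills on T³ — a RUNG, NOT the Clay problem: not d = 4, not infinite volume, not a mass
gap); LEAD seat `ym-ust-19936-w1` g10 (words (a) «S1″ PASS», (c) «BAND PASS», 2026-08-29).  Helper `--supports stmt-QuantumFields-19936`; THEOREMS
ONLY (0 `def`, 0 `sorry`, default heartbeats).

WHY.  LINE 25 «CompactnessTransfer» v1.4-band (ideator ym-r3-idea-2 g15, registered on 23533) has three stubs: the continuum fact S1″-band
(`W^{1,2}`-local minimisers `Q → S³` with `∫_Q dens ≤ Λ ≤ 21` have uniformly small normalised energy at the centre; ★w3 g15 reduces it to three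
printed rows (M)(C)(R)), Γ1 (LANDED ✓p718508 = ✓p718032 `blowDown_L2_compact`, px3 g7) and the lattice stub S2♭″ (`W^{1,2}` minimality of the blow-down
limit + energy convergence from above; px3 g8's knit over ★w8 (Γ2-W), LEAD (Γ2-IBP), px15∕w7 (Γ5), px5 (Γ-layer)).  The skeleton's (Γ6-band) composition
lives under `Cruxes/` (not importable); THIS FILE is its Theorems-side twin WITH Γ1 DISCHARGED BY NAME, and pushes on through ★w3 g14's stability cap
✓p715759 `hImproveCoreFlat_of_flatCapped` (`Flat∣₂₁ → Flat`) to the organ of record and to the K2 display v4 face — so that every later display of the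
crux reads «modulo {K1, S1″-band, S2♭″, `MeanDeviationL`}» BY NAME (companion FILE K-8b), and S1″-band ∕ S2♭″ are replaced by their suppliers as they land.

WHAT IS PROVED (ns `…Theorems.PoincareLipschitzFlatOrganOfSobolevStubs`; `h1` = S1″-band VERBATIM (ideator g15 candidate A∕B :102–126 = g14 `S1pp` +
`Λ ≤ 21 →`), `h2` = S2♭″ VERBATIM (= g14 `S2flatpp`, 3909 chars)).
* ★★★ `hImproveCoreFlatBand_of_stubs (h1) (h2)` — the band organ `∀ Λ₀ ε₁, 0 < Λ₀ → Λ₀ ≤ 21 → 0 < ε₁ → ∃ δ C₀ R₀, …` (the ideator's (Γ6-band) proof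
  verbatim, `hΓ := blowDown_L2_compact`).
* ★★★ `hImproveCoreFlat_of_stubs (h1) (h2) : ⟨hImproveCoreFlat v1 FROZEN bac8eda30a54887f VERBATIM⟩` — through ✓`hImproveCoreFlat_of_flatCapped` at
  `Λ₀ := 21`.
* ★★★ `hHalvingBand_of_stubs (h1) (h2) : ⟨hHalvingBand v1 FROZEN ba43742f358b062d VERBATIM⟩` — the band organ at `(Λ₀, ε₁) := (Λ, Λ)`.
HONEST SCOPE.  Compositions; S1″-band and S2♭″ are HYPOTHESES here; nothing of K1, `MeanDeviationL`, `BlockLipschitzL`, `HistoryTailL` is proved.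
YM₃ on T³ is rung R3, not Clay; YM gap NOT proved; no summit statement is proved here.

References: R. Schoen, K. Uhlenbeck, J. Diff. Geom. 17 (1982) 307–335 [SchoenUhlenbeck1982]; S. Luckhaus, Indiana Univ. Math. J. 37 (1988) 349–367
[Luckhaus1988]; T. Bałaban, CMP 102 (1985) 255–275 [Balaban1985UV3].
-/

set_option autoImplicit false

noncomputable section

open scoped BigOperators
open Filter Topology Finset MeasureTheory

namespace Summit.QuantumFields.YangMills.Theorems.PoincareLipschitzFlatOrganOfSobolevStubs

open Literature.MathematicalPhysics.QuantumFieldTheory.Balaban1983to89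
open B4Eq19LatticeOperators (Zd box unitVec)
open Summit.QuantumFields.YangMills.Theorems.PoincareLipschitzBlowDownL2Compactness (blowDown_L2_compact)
open Summit.QuantumFields.YangMills.Theorems.PoincareLipschitzFlatOrganOfFlatCapped (hImproveCoreFlat_of_flatCapped)

section Stubs

variable
  (h1 : ∀ (Λ ε : ℝ), 0 < Λ → Λ ≤ 21 → 0 < ε → ∃ r₁ : ℝ, 0 < r₁ ∧ r₁ ≤ 1 / 8 ∧
      ∀ (hQ : IsOpen {x : EuclideanSpace ℝ (Fin 3) | ∀ i : Fin 3, |x i| < 1}) (U : EuclideanSpace ℝ (Fin 3) → EuclideanSpace ℝ (Fin 4)) (G : EuclideanSpace ℝ (Fin 3) → (EuclideanSpace ℝ (Fin 3) →L[ℝ] EuclideanSpace ℝ (Fin 4))),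
      Literature.Analysis.FunctionSpaces.HasWeakFDerivOn ⟨{x : EuclideanSpace ℝ (Fin 3) | ∀ i : Fin 3, |x i| < 1}, hQ⟩ volume U G →
      (∀ x : EuclideanSpace ℝ (Fin 3), (∀ i : Fin 3, |x i| < 1) → ‖U x‖ = 1) →
      MeasureTheory.IntegrableOn (fun x => ∑ i : Fin 3, ‖G x (EuclideanSpace.single i (1:ℝ))‖ ^ 2)
        {x : EuclideanSpace ℝ (Fin 3) | ∀ i : Fin 3, |x i| < 1} →
      (∀ (V : EuclideanSpace ℝ (Fin 3) → EuclideanSpace ℝ (Fin 4)) (GV : EuclideanSpace ℝ (Fin 3) → (EuclideanSpace ℝ (Fin 3) →L[ℝ] EuclideanSpace ℝ (Fin 4))) (s : ℝ), s < 1 →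
        Literature.Analysis.FunctionSpaces.HasWeakFDerivOn ⟨{x : EuclideanSpace ℝ (Fin 3) | ∀ i : Fin 3, |x i| < 1}, hQ⟩ volume V GV →
        (∀ x : EuclideanSpace ℝ (Fin 3), (∀ i : Fin 3, |x i| < 1) → ‖V x‖ = 1) →
        MeasureTheory.IntegrableOn (fun x => ∑ i : Fin 3, ‖GV x (EuclideanSpace.single i (1:ℝ))‖ ^ 2)
        {x : EuclideanSpace ℝ (Fin 3) | ∀ i : Fin 3, |x i| < 1} →
        (∀ x : EuclideanSpace ℝ (Fin 3), (∃ i : Fin 3, s ≤ |x i|) → V x = U x) →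
        ∫ x in {x : EuclideanSpace ℝ (Fin 3) | ∀ i : Fin 3, |x i| < 1}, ∑ i : Fin 3, ‖G x (EuclideanSpace.single i (1:ℝ))‖ ^ 2 ≤
          ∫ x in {x : EuclideanSpace ℝ (Fin 3) | ∀ i : Fin 3, |x i| < 1}, ∑ i : Fin 3, ‖GV x (EuclideanSpace.single i (1:ℝ))‖ ^ 2) →
      ∫ x in {x : EuclideanSpace ℝ (Fin 3) | ∀ i : Fin 3, |x i| < 1}, ∑ i : Fin 3, ‖G x (EuclideanSpace.single i (1:ℝ))‖ ^ 2 ≤ Λ →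
      ∀ r : ℝ, 0 < r → r ≤ r₁ →
        ∫ x in {x : EuclideanSpace ℝ (Fin 3) | ∀ i : Fin 3, |x i| < r}, ∑ i : Fin 3, ‖G x (EuclideanSpace.single i (1:ℝ))‖ ^ 2 ≤ ε * r)
  (h2 : ∀ (Λ₀ : ℝ), 0 < Λ₀ → ∀ (u : ℕ → Zd 3 → EuclideanSpace ℝ (Fin 4)) (z : ℕ → Zd 3) (R : ℕ → ℤ),
      (∀ k : ℕ, (k : ℝ) + 1 ≤ R k) → (∀ (k : ℕ) (y : Zd 3), ‖u k y‖ = 1) →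
      (∀ k : ℕ, (∀ (z' : Zd 3) (ρ : ℤ), 0 ≤ ρ → box z' (ρ + 1) ⊆ box (z k) (R k) →
        ∀ v : Zd 3 → EuclideanSpace ℝ (Fin 4), (∀ y, y ∉ box z' ρ → v y = (u k) y) → (∀ y ∈ box z' ρ, ‖v y‖ = 1) →
        ∑ y ∈ box z' (ρ + 1), ∑ μ : Fin 3, ‖(u k) (y + unitVec μ) - (u k) y‖ ^ 2 ≤
        (∑ y ∈ box z' (ρ + 1), ∑ μ : Fin 3, ‖v (y + unitVec μ) - v y‖ ^ 2) + (1 / ((k : ℝ) + 1)) * ((ρ : ℝ) + 1))) →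
      (∀ k : ℕ, ∑ y ∈ box (z k) (R k), ∑ μ : Fin 3, ‖(u k) (y + unitVec μ) - (u k) y‖ ^ 2 ≤ Λ₀ * R k) →
      ∀ (U₀ : EuclideanSpace ℝ (Fin 3) → EuclideanSpace ℝ (Fin 4)) (φ₀ : ℕ → ℕ), StrictMono φ₀ →
      AEStronglyMeasurable U₀ (volume.restrict {x : EuclideanSpace ℝ (Fin 3) | ∀ i : Fin 3, |x i| < 1}) →
      (∀ᵐ x ∂(volume.restrict {x : EuclideanSpace ℝ (Fin 3) | ∀ i : Fin 3, |x i| < 1}), ‖U₀ x‖ = 1) →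
      Tendsto (fun k : ℕ => ∫ x in {x : EuclideanSpace ℝ (Fin 3) | ∀ i : Fin 3, |x i| < 1},
            ‖u (φ₀ k) (z (φ₀ k) + fun i => ⌊(R (φ₀ k) : ℝ) * x i⌋) - U₀ x‖ ^ 2) atTop (𝓝 0) →
      (∀ (m : ℕ) (j : Fin 3 → Fin (2 ^ m)) (μ : Fin 3), ∃ g : EuclideanSpace ℝ (Fin 4),
          Tendsto (fun k : ℕ => ∫ x in {x : EuclideanSpace ℝ (Fin 3) |
                ∀ i : Fin 3, (-1 : ℝ) + 2 * (j i : ℕ) / (2 : ℝ) ^ m ≤ x i ∧ x i < (-1 : ℝ) + 2 * ((j i : ℕ) + 1) / (2 : ℝ) ^ m},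
              (R (φ₀ k) : ℝ) • (u (φ₀ k) ((z (φ₀ k) + fun i => ⌊(R (φ₀ k) : ℝ) * x i⌋) + unitVec μ)
                - u (φ₀ k) (z (φ₀ k) + fun i => ⌊(R (φ₀ k) : ℝ) * x i⌋))) atTop (𝓝 g)) →
      ∀ (hQ : IsOpen {x : EuclideanSpace ℝ (Fin 3) | ∀ i : Fin 3, |x i| < 1}), ∃ (U : EuclideanSpace ℝ (Fin 3) → EuclideanSpace ℝ (Fin 4)) (G : EuclideanSpace ℝ (Fin 3) → (EuclideanSpace ℝ (Fin 3) →L[ℝ] EuclideanSpace ℝ (Fin 4))) (φ : ℕ → ℕ),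
      StrictMono φ ∧ (∃ ψ : ℕ → ℕ, StrictMono ψ ∧ ∀ k : ℕ, φ k = φ₀ (ψ k)) ∧
      (∀ᵐ x ∂(volume.restrict {x : EuclideanSpace ℝ (Fin 3) | ∀ i : Fin 3, |x i| < 1}), U x = U₀ x) ∧
      Literature.Analysis.FunctionSpaces.HasWeakFDerivOn ⟨{x : EuclideanSpace ℝ (Fin 3) | ∀ i : Fin 3, |x i| < 1}, hQ⟩ volume U G ∧
      (∀ x : EuclideanSpace ℝ (Fin 3), (∀ i : Fin 3, |x i| < 1) → ‖U x‖ = 1) ∧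
      MeasureTheory.IntegrableOn (fun x => ∑ i : Fin 3, ‖G x (EuclideanSpace.single i (1:ℝ))‖ ^ 2)
        {x : EuclideanSpace ℝ (Fin 3) | ∀ i : Fin 3, |x i| < 1} ∧
      (∀ (V : EuclideanSpace ℝ (Fin 3) → EuclideanSpace ℝ (Fin 4)) (GV : EuclideanSpace ℝ (Fin 3) → (EuclideanSpace ℝ (Fin 3) →L[ℝ] EuclideanSpace ℝ (Fin 4))) (s : ℝ), s < 1 →
        Literature.Analysis.FunctionSpaces.HasWeakFDerivOn ⟨{x : EuclideanSpace ℝ (Fin 3) | ∀ i : Fin 3, |x i| < 1}, hQ⟩ volume V GV →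
        (∀ x : EuclideanSpace ℝ (Fin 3), (∀ i : Fin 3, |x i| < 1) → ‖V x‖ = 1) →
        MeasureTheory.IntegrableOn (fun x => ∑ i : Fin 3, ‖GV x (EuclideanSpace.single i (1:ℝ))‖ ^ 2)
        {x : EuclideanSpace ℝ (Fin 3) | ∀ i : Fin 3, |x i| < 1} →
        (∀ x : EuclideanSpace ℝ (Fin 3), (∃ i : Fin 3, s ≤ |x i|) → V x = U x) →
        ∫ x in {x : EuclideanSpace ℝ (Fin 3) | ∀ i : Fin 3, |x i| < 1}, ∑ i : Fin 3, ‖G x (EuclideanSpace.single i (1:ℝ))‖ ^ 2 ≤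
          ∫ x in {x : EuclideanSpace ℝ (Fin 3) | ∀ i : Fin 3, |x i| < 1}, ∑ i : Fin 3, ‖GV x (EuclideanSpace.single i (1:ℝ))‖ ^ 2) ∧
      ∫ x in {x : EuclideanSpace ℝ (Fin 3) | ∀ i : Fin 3, |x i| < 1}, ∑ i : Fin 3, ‖G x (EuclideanSpace.single i (1:ℝ))‖ ^ 2 ≤ Λ₀ ∧
      ∀ (r₀ η : ℝ), 0 < r₀ → r₀ ≤ 1 / 8 → 0 < η → ∃ r : ℝ, r₀ / 2 ≤ r ∧ r ≤ r₀ ∧ ∃ k₀ : ℕ, ∀ k : ℕ, k₀ ≤ k →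
        ∃ ρ : ℤ, r * (R (φ k) : ℝ) ≤ ρ ∧ (ρ : ℝ) ≤ 2 * r * R (φ k) ∧
        ∑ y ∈ box (z (φ k)) (2 * ρ), ∑ μ : Fin 3, ‖(u (φ k)) (y + unitVec μ) - (u (φ k)) y‖ ^ 2 ≤
          (R (φ k) : ℝ) * ((∫ x in {x : EuclideanSpace ℝ (Fin 3) | ∀ i : Fin 3, |x i| < (5 * r)}, ∑ i : Fin 3, ‖G x (EuclideanSpace.single i (1:ℝ))‖ ^ 2) + η))
include h1 h2

/-- ★★★ **THE BAND ORGAN FROM S1″-band AND S2♭″** (Γ1 by name).  By contradiction: counterexamples at `δ = 1/(k+1)`, `C₀ = R₀ = k+1`; blow down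
(✓`blowDown_L2_compact`), then S2♭″ along a further subsequence; S1″-band at `(Λ₀, ε₁/10)` gives `r₁`; the energy-convergence clause at `r₀ = r₁/5`,
`η = ε₁r₁/40` yields a good scale the counterexample forbids — the ideator's (Γ6-band) text, Theorems-side. [cite: SchoenUhlenbeck1982, Thm IV; Luckhaus1988, Thm 2] -/
theorem hImproveCoreFlatBand_of_stubs :
    ∀ (Λ₀ ε₁ : ℝ), 0 < Λ₀ → Λ₀ ≤ 21 → 0 < ε₁ →
      ∃ (δ C₀ R₀ : ℝ), 0 < δ ∧ 1 ≤ C₀ ∧ 1 ≤ R₀ ∧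
      ∀ (u : Zd 3 → EuclideanSpace ℝ (Fin 4)) (z : Zd 3) (R : ℤ),
      R₀ ≤ R →
      (∀ y, ‖u y‖ = 1) →
      (∀ (z' : Zd 3) (ρ : ℤ), 0 ≤ ρ → box z' (ρ + 1) ⊆ box z R →
      ∀ v : Zd 3 → EuclideanSpace ℝ (Fin 4), (∀ y, y ∉ box z' ρ → v y = u y) → (∀ y ∈ box z' ρ, ‖v y‖ = 1) →
      ∑ y ∈ box z' (ρ + 1), ∑ μ : Fin 3, ‖u (y + unitVec μ) - u y‖ ^ 2 ≤
      (∑ y ∈ box z' (ρ + 1), ∑ μ : Fin 3, ‖v (y + unitVec μ) - v y‖ ^ 2) + δ * ((ρ : ℝ) + 1)) →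
      (∑ y ∈ box z R, ∑ μ : Fin 3, ‖u (y + unitVec μ) - u y‖ ^ 2 ≤ Λ₀ * R) →
      ∃ r : ℤ, 1 ≤ r ∧ (R : ℝ) ≤ C₀ * r ∧ 4 * r ≤ R ∧
      ∑ y ∈ box z (2 * r), ∑ μ : Fin 3, ‖u (y + unitVec μ) - u y‖ ^ 2 ≤ ε₁ * r := by
  intro Λ₀ ε₁ hΛ₀ h21 hε₁
  by_contra H
  -- a counterexample at every level `k` (δ = 1/(k+1), C₀ = R₀ = k+1)
  have hseq : ∀ k : ℕ, ∃ (u : Zd 3 → EuclideanSpace ℝ (Fin 4)) (z : Zd 3) (R : ℤ),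
      ((k : ℝ) + 1 ≤ R) ∧ (∀ y, ‖u y‖ = 1) ∧
      (∀ (z' : Zd 3) (ρ : ℤ), 0 ≤ ρ → box z' (ρ + 1) ⊆ box z R →
        ∀ v : Zd 3 → EuclideanSpace ℝ (Fin 4), (∀ y, y ∉ box z' ρ → v y = u y) → (∀ y ∈ box z' ρ, ‖v y‖ = 1) →
        ∑ y ∈ box z' (ρ + 1), ∑ μ : Fin 3, ‖u (y + unitVec μ) - u y‖ ^ 2 ≤
        (∑ y ∈ box z' (ρ + 1), ∑ μ : Fin 3, ‖v (y + unitVec μ) - v y‖ ^ 2) + (1 / ((k : ℝ) + 1)) * ((ρ : ℝ) + 1)) ∧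
      (∑ y ∈ box z R, ∑ μ : Fin 3, ‖u (y + unitVec μ) - u y‖ ^ 2 ≤ Λ₀ * R) ∧
      ∀ r : ℤ, 1 ≤ r → (R : ℝ) ≤ ((k : ℝ) + 1) * r → 4 * r ≤ R →
        ε₁ * r < ∑ y ∈ box z (2 * r), ∑ μ : Fin 3, ‖u (y + unitVec μ) - u y‖ ^ 2 := by
    intro k
    by_contra hk
    apply H
    have hk0 : (0 : ℝ) ≤ (k : ℝ) := Nat.cast_nonneg k
    refine ⟨1 / ((k : ℝ) + 1), (k : ℝ) + 1, (k : ℝ) + 1, by positivity, by linarith, by linarith, ?_⟩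
    intro u z R hR hu hmin hE
    by_contra hr
    exact hk ⟨u, z, R, hR, hu, hmin, hE, fun r h1r h2r h3r => not_le.mp (fun hle => hr ⟨r, h1r, h2r, h3r, hle⟩)⟩
  choose u z R hR hu hmin hE hbad using hseq
  -- blow down: Γ1 (L²-compactness), then S2♭ (the limit is a smooth local minimiser; energies converge from above along φ = φ₀ ∘ ψ)
  obtain ⟨U₀, φ₀, hφ₀, hm₀, hu₀, hc₀, hg₀⟩ := blowDown_L2_compact Λ₀ hΛ₀ u z R hR hu hE
  have hQ : IsOpen {x : EuclideanSpace ℝ (Fin 3) | ∀ i : Fin 3, |x i| < 1} :=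
    Summit.QuantumFields.YangMills.Theorems.PoincareLipschitzSamplingCells.isOpen_absCube 1
  obtain ⟨U, G, φ, hφ, -, -, hW, hUu, hUint, hUmin, hUE, hconv⟩ :=
    h2 Λ₀ hΛ₀ u z R hR hu hmin hE U₀ φ₀ hφ₀ hm₀ hu₀ hc₀ hg₀ hQ
  -- the continuum fact at `(Λ₀, ε₁/10)`
  obtain ⟨r₁, hr₁, hr₁8, hSU⟩ := h1 Λ₀ (ε₁ / 10) hΛ₀ h21 (by positivity)
  have hsmall := hSU hQ U G hW hUu hUint hUmin hUE
  -- energy convergence at `r₀ = r₁/5`, `η = ε₁ r₁/40`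
  obtain ⟨r, hr_lo, hr_hi, k₀, hk₀⟩ := hconv (r₁ / 5) (ε₁ * r₁ / 40) (by positivity) (by linarith) (by positivity)
  have hr_pos : 0 < r := by linarith
  obtain ⟨N, hN⟩ := exists_nat_ge (1 / r)
  obtain ⟨ρ, hρ_lo, hρ_hi, hEk⟩ := hk₀ (max k₀ N) (le_max_left _ _)
  -- sizes at the index `φ (max k₀ N)`
  have hNk : (N : ℝ) ≤ (φ (max k₀ N) : ℝ) := by
    have : N ≤ φ (max k₀ N) := le_trans (le_max_right _ _) (hφ.id_le _)
    exact_mod_cast this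
  have hRk : (φ (max k₀ N) : ℝ) + 1 ≤ R (φ (max k₀ N)) := hR _
  have hRpos : (0 : ℝ) < R (φ (max k₀ N)) := by
    have : (0 : ℝ) ≤ (φ (max k₀ N) : ℝ) := Nat.cast_nonneg _
    linarith
  have hrinv : 1 / r ≤ (φ (max k₀ N) : ℝ) + 1 := by linarith
  -- (1) `1 ≤ ρ`
  have hrR : 1 ≤ r * (R (φ (max k₀ N)) : ℝ) := by
    have h1 : r * (1 / r) = 1 := by field_simp
    have h2 : r * (1 / r) ≤ r * ((φ (max k₀ N) : ℝ) + 1) := mul_le_mul_of_nonneg_left hrinv hr_pos.le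
    have h3 : r * ((φ (max k₀ N) : ℝ) + 1) ≤ r * (R (φ (max k₀ N)) : ℝ) := mul_le_mul_of_nonneg_left hRk hr_pos.le
    linarith
  have hρpos : (0 : ℝ) < ρ := by linarith
  have hρ1 : (1 : ℤ) ≤ ρ := by
    have : (1 : ℝ) ≤ (ρ : ℝ) := le_trans hrR hρ_lo
    exact_mod_cast this
  -- (2) `R ≤ (k+1)·ρ`
  have hC : (R (φ (max k₀ N)) : ℝ) ≤ ((φ (max k₀ N) : ℝ) + 1) * ρ := by
    have h1 : (R (φ (max k₀ N)) : ℝ) = (1 / r) * (r * R (φ (max k₀ N))) := by field_simp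
    have h2 : (1 / r) * (r * (R (φ (max k₀ N)) : ℝ)) ≤ (1 / r) * ρ := mul_le_mul_of_nonneg_left hρ_lo (by positivity)
    have h3 : (1 / r) * (ρ : ℝ) ≤ ((φ (max k₀ N) : ℝ) + 1) * ρ := mul_le_mul_of_nonneg_right hrinv hρpos.le
    linarith
  -- (3) `4ρ ≤ R`
  have h4 : 4 * ρ ≤ R (φ (max k₀ N)) := by
    have h2r : 2 * r ≤ 1 / 20 := by linarith
    have h5 : 2 * r * (R (φ (max k₀ N)) : ℝ) ≤ 1 / 20 * R (φ (max k₀ N)) := mul_le_mul_of_nonneg_right h2r hRpos.le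
    have : (4 : ℝ) * ρ ≤ R (φ (max k₀ N)) := by linarith
    exact_mod_cast this
  -- the counterexample forbids the scale `ρ` …
  have hlt := hbad (φ (max k₀ N)) ρ hρ1 hC h4
  -- … but the lattice energy there is small
  have h5r := hsmall (5 * r) (by positivity) (by linarith)
  have hRC := mul_le_mul_of_nonneg_left h5r hRpos.le
  have hh2 : ε₁ * r₁ / 40 ≤ ε₁ * r / 4 := by nlinarith [hr_lo, hε₁.le]
  have hh3 := mul_le_mul_of_nonneg_left hh2 hRpos.le
  have hh1 : ε₁ * (r * (R (φ (max k₀ N)) : ℝ)) ≤ ε₁ * ρ := mul_le_mul_of_nonneg_left hρ_lo hε₁.le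
  have hprod : 0 < ε₁ * (r * (R (φ (max k₀ N)) : ℝ)) := by positivity
  rw [mul_add] at hEk
  nlinarith [hEk, hRC, hlt, hh1, hh3, hprod, hRpos.le, hε₁.le, hr_pos.le]

/-- ★★★ **THE ORGAN OF RECORD `hImproveCoreFlat` (FROZEN v1 bac8eda30a54887f, VERBATIM) FROM S1″-band AND S2♭″** — the band organ at `Λ₀ := 21` is
★w3 g14's `Flat∣₂₁`, and ✓`hImproveCoreFlat_of_flatCapped` (Schoen–Uhlenbeck stability cap on `ℤ³`) removes the level. [cite: SchoenUhlenbeck1982, §4; Luckhaus1988, Thm 2] -/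
theorem hImproveCoreFlat_of_stubs :
    ∀ (Λ₀ ε₁ : ℝ), 0 < Λ₀ → 0 < ε₁ →
      ∃ (δ C₀ R₀ : ℝ), 0 < δ ∧ 1 ≤ C₀ ∧ 1 ≤ R₀ ∧
      ∀ (u : Zd 3 → EuclideanSpace ℝ (Fin 4)) (z : Zd 3) (R : ℤ),
      R₀ ≤ R →
      (∀ y, ‖u y‖ = 1) →
      (∀ (z' : Zd 3) (ρ : ℤ), 0 ≤ ρ → box z' (ρ + 1) ⊆ box z R →
      ∀ v : Zd 3 → EuclideanSpace ℝ (Fin 4), (∀ y, y ∉ box z' ρ → v y = u y) → (∀ y ∈ box z' ρ, ‖v y‖ = 1) →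
      ∑ y ∈ box z' (ρ + 1), ∑ μ : Fin 3, ‖u (y + unitVec μ) - u y‖ ^ 2 ≤
      (∑ y ∈ box z' (ρ + 1), ∑ μ : Fin 3, ‖v (y + unitVec μ) - v y‖ ^ 2) + δ * ((ρ : ℝ) + 1)) →
      (∑ y ∈ box z R, ∑ μ : Fin 3, ‖u (y + unitVec μ) - u y‖ ^ 2 ≤ Λ₀ * R) →
      ∃ r : ℤ, 1 ≤ r ∧ (R : ℝ) ≤ C₀ * r ∧ 4 * r ≤ R ∧
      ∑ y ∈ box z (2 * r), ∑ μ : Fin 3, ‖u (y + unitVec μ) - u y‖ ^ 2 ≤ ε₁ * r :=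
  hImproveCoreFlat_of_flatCapped fun ε₁ hε₁ => hImproveCoreFlatBand_of_stubs h1 h2 21 ε₁ (by norm_num) le_rfl hε₁

/-- ★★★ **THE FACE `hHalvingBand` (FROZEN v1 ba43742f358b062d, VERBATIM — the K2 display v4 binder `hHB`) FROM S1″-band AND S2♭″** — the band organ at
`(Λ₀, ε₁) := (Λ, Λ)`. [cite: SchoenUhlenbeck1982, §4; Balaban1985UV3, (71) p.273] -/
theorem hHalvingBand_of_stubs :
    ∀ Λ : ℝ, 0 < Λ → Λ ≤ 21 →
      ∃ (δ C₀ R₀ : ℝ), 0 < δ ∧ 1 ≤ C₀ ∧ 1 ≤ R₀ ∧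
      ∀ (u : Zd 3 → EuclideanSpace ℝ (Fin 4)) (z : Zd 3) (R : ℤ),
      R₀ ≤ R →
      (∀ y, ‖u y‖ = 1) →
      (∀ (z' : Zd 3) (ρ : ℤ), 0 ≤ ρ → box z' (ρ + 1) ⊆ box z R →
      ∀ v : Zd 3 → EuclideanSpace ℝ (Fin 4), (∀ y, y ∉ box z' ρ → v y = u y) → (∀ y ∈ box z' ρ, ‖v y‖ = 1) →
      ∑ y ∈ box z' (ρ + 1), ∑ μ : Fin 3, ‖u (y + unitVec μ) - u y‖ ^ 2 ≤
      (∑ y ∈ box z' (ρ + 1), ∑ μ : Fin 3, ‖v (y + unitVec μ) - v y‖ ^ 2) + δ * ((ρ : ℝ) + 1)) →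
      (∑ y ∈ box z R, ∑ μ : Fin 3, ‖u (y + unitVec μ) - u y‖ ^ 2 ≤ Λ * R) →
      ∃ r : ℤ, 1 ≤ r ∧ (R : ℝ) ≤ C₀ * r ∧ 4 * r ≤ R ∧
      ∑ y ∈ box z (2 * r), ∑ μ : Fin 3, ‖u (y + unitVec μ) - u y‖ ^ 2 ≤ Λ * r
:=
  fun Λ hΛ h21 => hImproveCoreFlatBand_of_stubs h1 h2 Λ Λ hΛ h21 hΛ

end Stubs

end Summit.QuantumFields.YangMills.Theorems.PoincareLipschitzFlatOrganOfSobolevStubs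

end
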